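import Mathlib
import HarnessLib
import HarnessLib.Audit
import Summits.CriticalPhenomena.Statement
import Literature.Probability.LatticeModels.FermionicObservable
import Literature.Probability.Percolation.InterfaceScalingLimit
import Literature.Probability.Percolation.InterfaceScalingLimitDiscretised
import HarnessLib.Audit.Status.Attr

/-!
Route: CardyDualCurrent

# Route CardyDualCurrent — decide the dual-current question on Z^2 — an exactly discrete-holomorphic
local parafermionic template (or a certified no-go), then Smirnov's q=1 programme via SLE6

It suffices to show X = DualCurrentTemplateR (REPAIRED 2026-08-15: the first typing
DualCurrentTemplate, stmt-CriticalPhenomena-6949, was refuted-MISSTATED by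
Theorems.CardyDualCurrentDualCurrentTemplate_refuted — Mathlib's junk `SimpleGraph.dist = 0` on
unreachable pairs put the isolated non-edge s(0,0) into every
window, so no window was interior and the statement was vacuous; every ball/window is now measured
with the reachability-aware `medialGraph.edist : ℕ∞`,
under which the witness sits at ⊤ and only genuine lattice edges within medial distance r count;
card root-of-unity-dual-current, its C2 "dual pair" in the form the novelty audit
left standing: one density conserved with respect to BOTH transfer directions): there is a
finite-range LOCAL PARAFERMIONIC TEMPLATE —
a finite sum of (local function of the bond configuration in the medial ball of radius r) x (winding
phase exp(-i s W) of the
percolation exploration path at a passage through a medial vertex of that ball), spins s free —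
whose expectation under bond
percolation at p = 1/2, in EVERY admissible discrete Dobrushin domain of δZ^2, is EXACTLY discrete
holomorphic on the medial lattice
(Duffin/Smirnov Cauchy–Riemann around every primal vertex and every primal face whose four medial
vertices carry interior windows) and
non-degenerate between DEEP windows (not constant on the medial vertices whose radius-(r+2) windows
are interior, so that every demanded
equation touching the witnesses is in force — rev 5, closing the boundary-layer loophole of the
route review). Given X, the transfer cruxes (exact CR ⇒ canonical limit θ_δ·C·δ^(-1/3)·G → (π
Φ')^(1/3) locally uniformly, Φ the strip map, along EVERY admissible
square-lattice discretisation family of every Dobrushin domain — rev 9: the canonical-data guard `∀ᶠ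
δ, (dobrushinData D δ).IsZdAdmissible`,
generically vacuous, is gone from the whole chain, which now mirrors the reviewed σ = 1/2 rendering
fkIsingObservable_tendstoLocallyUniformlyOn_sqrt_deriv_of_isDiscretisation; canonical martingale
limit ⇒ SLE6InterfaceLimit, the
all-discretisations SLE₆ convergence = Smirnov ICM 2006 Conj. 4 at q = 1 INLINED as an item and
shared with CardyViaSLE6 / CardyRotToConf;
SLE6InterfaceLimit ⇒ Cardy) give CardyFormulaZ2. The negative side (no such template of
medial range ≤ 1, resp. 0, windings read mod 6π) is filed as ranked statements: its proof extends
the barrier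
FKParafermionicHalfCauchyRiemann from one observable to the whole finite-range template class and is
this route's decision value.
Lean: `∃ (r m : ℕ) (z : Fin 2 → Fin m → Literature.Probability.LatticeModels.MedialVertex) (s : Fin
2 → Fin m → ℝ) (g : Fin 2 → Fin m → Set Literature.Probability.LatticeModels.MedialVertex → ℂ), (∀ i
k, Literature.Probability.LatticeModels.medialGraph.edist s((0 :
Literature.Probability.LatticeModels.Site 2), Pi.single i 1) (z i k) ≤ (r : ℕ∞)) ∧ (let G :
Literature.Probability.LatticeModels.DiscreteDobrushin → Literature.Probability.LatticeModels.Site 2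
→ Fin 2 → ℂ := fun D x i => ∫ cfg, (∑ k, g i k {e |
Literature.Probability.LatticeModels.medialGraph.edist s((0 :
Literature.Probability.LatticeModels.Site 2), Pi.single i 1) e ≤ (r : ℕ∞) ∧ Sym2.map (· + x) e ∈
cfg} * Literature.Probability.LatticeModels.passageSum
(Literature.Probability.LatticeModels.fkInterface D cfg) D.δ (s i k) (Sym2.map (· + x) (z i k)))
∂(Literature.Probability.Percolation.bondPercolation (Literature.Probability.LatticeModels.zdGraph
2) Literature.Probability.Percolation.half); let W :
Literature.Probability.LatticeModels.DiscreteDobrushin → Literature.Probability.LatticeModels.Site 2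
→ Fin 2 → ℕ → Prop := fun D x i ρ => ∀ e, Literature.Probability.LatticeModels.medialGraph.edist
s((0 : Literature.Probability.LatticeModels.Site 2), Pi.single i 1) e ≤ (ρ : ℕ∞) → Sym2.map (· + x)
e ∈ D.innerMedialVertices; (∀ D : Literature.Probability.LatticeModels.DiscreteDobrushin,
D.IsZdAdmissible → ((Literature.Probability.LatticeModels.discreteDomainGraph D.Ω D.δ).induce
D.zdArcA).Preconnected → (∀ x, W D x 0 r → W D x 1 r → W D (x - Pi.single 0 1) 0 r → W D (x -
Pi.single 1 1) 1 r → G D x 1 - G D (x - Pi.single 1 1) 1 = Complex.I * (G D x 0 - G D (x - Pi.single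
0 1) 0)) ∧ (∀ f, W D f 0 r → W D (f + Pi.single 1 1) 0 r → W D f 1 r → W D (f + Pi.single 0 1) 1 r →
G D (f + Pi.single 1 1) 0 - G D f 0 = Complex.I * (G D (f + Pi.single 0 1) 1 - G D f 1))) ∧ ¬ (∀ D :
Literature.Probability.LatticeModels.DiscreteDobrushin, D.IsZdAdmissible →
((Literature.Probability.LatticeModels.discreteDomainGraph D.Ω D.δ).induce D.zdArcA).Preconnected →
∀ x x' i, W D x i (r + 2) → W D x' i (r + 2) → G D x i = G D x' i))`

## Assembly
Pure logic (the deciding theorem `closes : DualCurrentTemplateR → CanonicalLimitFromExactCR →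
MartingaleToSLE6 → SLE6ToCardy → CardyFormulaZ2 :=
fun h2 h4 h5 h9 => h9 (h5 (h4 h2))`, certified): DualCurrentTemplateR and CanonicalLimitFromExactCR
give TemplateCanonicalLimit (family version); MartingaleToSLE6 turns it into SLE6InterfaceLimit (all
discretisations); SLE6ToCardy yields CardyFormulaZ2. NoDualCurrentRangeOne /
RangeZero are the negative side and are not hypotheses of the assembly.

Rationale: WHY THIS LINE. Every exact local linear relation known for a winding-weighted interface observable
of an integrable loop model is the continuity
equation of ONE Bernard–Felder current (IkhlefWestonWheelerZinnJustin2013 §4, §9: "the dual equation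
is missing"; IkhlefWeston2017 §7:
whether "fully discretely-holomorphic operators" exist "remains open"); for bond-Z^2 percolation (q
= 1, σ = 1/3) this is exactly
DCS Prop. 8.6 / Duminil-Copin 2012 Prop. 4, half of Cauchy–Riemann, and the barrier file proves the
half-relations alone determine
nothing. Nobody has DECIDED whether a second, independent exact relation exists once local
correction terms and all winding classes
(mod 6π, i.e. spins in (1/3)Z — the arithmetic of percolation's root of unity ζ12) are allowed: the
positive answer is Smirnov 2010
Conj. 2.4 / DCS Question 8.15 made concrete at q = 1 and feeds the FK-Ising-style martingale
machinery already in Literature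
(isSLELaw_of_isLocalMartingale_driving, KemppainenSmirnov2017) at κ = 6; the negative answer at each
range is a finite exact
linear-algebra statement over Q(ζ12) (kit-decidable at range 0–1 with the S18 audit enumerator
pattern of FKInterfacePairing.lean) and
a new barrier fact. Imported areas: quantum-group current formalism (as the source of candidates and
of the prior), discrete complex
analysis (Riemann BVP with spin 1/3), SLE martingale identification; what it does that
CardyDiscreteHolo does not: it replaces the
informal "exhibit H_j" construction crux by a typed, per-range decidable existence statement with an
explicit negative side.

RANKED CRUXES. #2 DualCurrentTemplateR (crux) — X itself, REPAIRED (edist windows; non-degeneracy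
between (r+2)-deep windows since rev 5; replaces the refuted-misstated stmt-6949 whose dist-windows
were vacuous): some finite-range local parafermionic template has an exactly discrete-holomorphic
(both transfer-direction conservation laws = Duffin CR on the medial lattice at every deep primal
vertex and face), deep-window non-degenerate percolation expectation in every admissible discrete
Dobrushin domain of δZ^2 with connected wired arc (card C2, positive branch). [difficulty:
open-problem] (why it might fail: Prior is NO: each Bernard–Felder current gives one continuity
equation only (IWWZJ 2013 §9, IW 2017 §7 open); the q=2 second relation is a free-fermion argument
constraint absent at σ=1/3; Zhou 2024's second identity (96) is only O((δ/d)^2); honest edist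
windows make CR bite at every deep stencil.) [IkhlefWestonWheelerZinnJustin2013, IkhlefWeston2017,
DuminilCopinSmirnov2012Lattice, DuminilCopin2012Parafermion, Smirnov2010, Zhou2024SLE6BondZ2]
#3 NoDualCurrentRangeOne (crux) — RESTATED to edist balls (the dist typing was vacuously TRUE);
negative side at medial range ≤ 1: no template whose passage vertices and local configuration factor
live in the medial ball of radius 1 (5 edges) and whose windings are read modulo 6π (spins n/3) is
exactly CR and non-degenerate in all admissible domains — a finite linear system over Q(ζ12) (≈
2·5·12·32 unknowns) killed by exact expectations on small Dobrushin boxes; its proof is the first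
"all templates of range 1" extension of FKParafermionicHalfCauchyRiemann. [difficulty: L] (why it
might fail: False exactly if the positive branch already wins at range 1; and a proof needs exact
expectations on ≥ 5x5 Dobrushin boxes (2^40 configurations or a winding-tracking transfer matrix)
whose certificate may be too large to import into Lean.) [DuminilCopin2013Parafermion,
IkhlefCardy2009, AlamBatchelor2014, BondesanEtAl2015]
#4 CanonicalLimitFromExactCR (crux) — RESTATED rev 9 (consequent = the FAMILY version of
TemplateCanonicalLimit; antecedent = body of DualCurrentTemplateR, unchanged): exact discrete
holomorphicity forces the canonical scaling limit along every admissible square-lattice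
discretisation family: from any witness of DualCurrentTemplateR (witness may be re-chosen /
renormalised at finite range near the boundary) one gets a local template and a lattice constant C >
0 with θ_δ·C·δ^(-1/3)·G_{E δ} → q, q^3 = ψ'/ψ (q = (πΦ')^(1/3), Φ the strip map), locally uniformly
on D, for every Dobrushin domain D, every ZdDiscretisationFamily E of D and every chordal
uniformizer — Smirnov 2010 Thm 2.2 at σ = 1/3 in the shape of the reviewed σ = 1/2 fact
fkIsingObservable_tendstoLocallyUniformlyOn_sqrt_deriv_of_isDiscretisation (unit phases θ_δ absorb
the mesh-dependent winding origin). [deps: DualCurrentTemplateR] [difficulty: XL] (why it might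
fail: even with full CR the spin-1/3 Riemann BVP lacks Smirnov's integrable primitive Im∫F^2 (one
would need Im∫F^3 dz discretely), and CR is not demanded in the width-r boundary layer, where RSW
must control the defect.) [Smirnov2010, ChelkakSmirnov2012, DuminilCopinSmirnov2012Lattice]
#5 MartingaleToSLE6 (crux) — RESTATED rev 9 (TemplateCanonicalLimit, family version →
SLE6InterfaceLimit, all discretisations; was `→ Literature SLE6LimitZ2`, canonical data): a local
template observable with the canonical spin-1/3 limit along every admissible discretisation family
is a martingale observable of the exploration (domain Markov property of percolation: the slit data
are again admissible discrete Dobrushin data) and identifies every subsequential limit of the ℤ²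
exploration interface, along every ZdDiscretisationFamily, as chordal SLE₆ (κ = 6 from the Itô
computation with exponent 1/3) — the q = 1 twin of the Literature FK-Ising chain
(FKIsingDrivingMartingale, isSLELaw_of_isLocalMartingale_driving). [deps: CanonicalLimitFromExactCR]
[difficulty: L–XL] (why it might fail: identification reads the observable in random rough slit
domains and needs convergence uniform in the Carathéodory topology (Smirnov 2010 Rem. 2.3, KS17 §4),
more than the per-family antecedent literally gives; the local factor must be domain-Markov
compatible; tightness for general families is not yet in tree.) [KemppainenSmirnov2017, Smirnov2010,
CDHKSCRAS2014, DuminilCopinSmirnov2012Lattice, CamiaNewman2007, LawlerSchrammWerner2001]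
#6 SLE6InterfaceLimit (crux, by signature shared with CardyRotToConf / CardyViaSLE6 = stmt-11283) —
the conjecture leaf INLINED (rev 9; replaces the rev-8 by-name item SLE6LimitZ2 := Literature
SLE6LimitZ2, whose canonical-data guard is generically vacuous and whose presence in the cone kept
the route unstaffable): the body of Literature SLE6LimitZ2AllDiscretisations verbatim — SLE₆
convergence of bondInterfaceIn D (E δ) for every Dobrushin domain and every ZdDiscretisationFamily
(Smirnov ICM 2006 Conj. 4 at q = 1). OUTPUT of r2 → r4 → r5, INPUT of SLE6ToCardy, not a hypothesis
of `closes`. [difficulty: open-problem] (why it might fail: open; false if ℤ² subsequential limits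
are non-unique or only similarity-covariant; reachable here only through r2→r4→r5.) [Smirnov2007ICM,
Schramm2007ICM, CamiaNewman2007]
#9 TemplateCanonicalLimit (support) — RESTATED rev 9, family version (DCS Conj. 8.7 / Smirnov 2010
Conj. 2.4 at q = 1 for SOME finite-range local template): a local parafermionic template and C > 0
such that for every Dobrushin domain, every ZdDiscretisationFamily E, every chordal uniformizer φ
(inverse ψ) and every holomorphic branch q of (ψ'/ψ)^(1/3) there are unit phases θ_δ with
θ_δ·C·δ^(-1/3)·G_{E δ}(⌊w/δ⌋, i) → q(w) locally uniformly on D (both edge types i). Proving it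
outright closes r2's purpose and r4; non-vacuity rests on DiscretisationsExist (sibling support),
not on canonical-data admissibility. [difficulty: open-problem] [Smirnov2010,
DuminilCopinSmirnov2012Lattice, CDHKSCRAS2014]
#9 SLE6ToCardy (support, = stmt-10278 shared with CardyRotToConf) — RESTATED rev 9 (antecedent
SLE6InterfaceLimit, all discretisations): SLE₆ convergence of the ℤ² exploration interface along
every admissible discretisation family gives Cardy's formula for every conformal rectangle (choose
discretisations of (Ω; a, c) aligned with the discrete arcs; crossing = interface hits (cd)_δ before
(bc)_δ up to boundary 3-arm events; portmanteau + sle_six_measureReal_hitsBefore); the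
canonical-data approximation caveat disappears since the prover picks the family. [difficulty: L]
[CamiaNewman2007, Smirnov2001, Werner2007, LawlerSchrammWerner2001]
#9 NoDualCurrentRangeZero (support) — RESTATED to edist balls (range 0 = the base edge itself);
range-0 warm-up and pipeline validation of the negative side: no reweighting of Smirnov's vertex
observable by the state of the base edge and the winding class mod 6π (2·12·2 unknowns per vertex
type) is exactly CR and non-degenerate; decidable by brute-force exact enumeration on 4x4–5x5
Dobrushin boxes. [difficulty: M] [DuminilCopin2012Parafermion, Smirnov2010]

TWO-LAYER PLAN. Foreseen glued splits once a crux closes (none filed now): NoDualCurrentRangeOne ⇐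
LocalSufficiencyLemma (window-wise vanishing for
every exterior connectivity/winding pattern ⇒ identity in all domains) → RangeOneCertificate (exact
kernel of the small-box system is
trivial) → NoDualCurrentRangeOne; CanonicalLimitFromExactCR ⇐ Precompactness (discrete Harnack for
CR templates + RSW boundary layer) →
BoundaryValueIdentification (spin-1/3 Riemann BVP uniqueness) → CanonicalLimitFromExactCR;
MartingaleToSLE6 ⇐ MartingaleProperty
(domain Markov for template observables) → DrivingIdentification (κ = 6 via
isSLELaw_of_isLocalMartingale_driving) → MartingaleToSLE6.

KILL CRITERIA. A proof of ¬DualCurrentTemplateR (no exactly-CR local template of ANY range — e.g.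
from the representation theory of the Bernard–Felder
currents: "every twisted-local conserved density has exactly one continuity equation") closes the
route `refuted:DualCurrentTemplateR`
and is handed to the barrier catalogue as the all-templates form of
FKParafermionicHalfCauchyRiemann. Proofs of NoDualCurrentRangeZero,
RangeOne and a range-2 sibling with no surviving candidate, plus failure of the window-sufficiency
analysis at range ≤ 2, make r2
implausible: close `exhausted` with the census and tilt staffing to the non-identity cards
(curl-defect-mixing-rate, susy-ward,
spectral routes). SLE6InterfaceLimit proved elsewhere (it is the target of CardyViaSLE6 /
CardyRotToConf, shared by signature) moots r4–r5 but not the decision r2/r3.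

NOT DECOMPOSED YET. Which second relation the census should also accept beyond Duffin CR of the
vertex function (the ultra-local per-medial-vertex pair
"F(NW)−F(SE)=i[F(NE)−F(SW)] and F(NW)+F(SE)=F(NE)+F(SW)" of the q=2 edge observable, any fixed
stencil): variants are restated by
grounders, not new items. Quasi-local (exponentially localised) templates — the root-of-unity-only
charges of the XXZ chain at Δ=−1/2 —
are outside the finite-range class on purpose (r → ∞ is a later route). Boundary-layer control, the
martingale property for local
factors, and the discretisation conventions (vertex vs edge observable, winding origin e_a vs e_b —
a constant phase) are layer-2.

CHEAPEST FALSIFIER. Run the range-0 census (NoDualCurrentRangeZero): adapt the exact-enumeration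
auditor used for S18 (FKInterfacePairing.lean docstring:
H21's bcBondConfig / nextCorner-orbit interface / windingAt / passageSum transcribed to C) to q = 1,
p = 1/2, phases ζ12^(-n·k), and
compute the Q(ζ12)-kernel of the CR-defect functionals of all deep faces of all Dobrushin 4x4 and
5x5 boxes (2^24–2^40 configurations)
on the 48-dimensional range-0 template space: expected EMPTY beyond constants (the barrier's kernel
count predicts NO). A non-empty
persistent kernel would be the positive branch found; I could not run it here (hub is compute-free
and kit was not in this unit's payload).

NUMBERS. σ = 1 − (2/π) arccos(√q/2) = 1/3 at q = 1; κ = 4π/arccos(−√q/2) = 6; winding classes of a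
medial passage on Z^2 mod 6π ↔ Z/12, phases in
Q(ζ12); unknowns of the range-r census: 2 · |B_r| · 12 · 2^|B_r| with |B_0| = 1, |B_1| = 5, |B_2| =
13 (48; 3840; ≈ 2.6·10^6);
half-CR count (barrier, proved): 2·#equations ≤ #unknowns, dim halfCRSolutions ≥ #equations. Items
at open: 8 (4 cruxes); after the 2026-08-15 repair (rev 4–8): 10 active items; after rev 9: 10
active items (5 cruxes r2–r6, 4 supports, 1 assembly) + the settled negative edge stmt-6949 (dropped
from the assembly, kept in the negatives index). Scaling: δ^(-σ)F → (Φ')^σ with σ = 1/3 (Smirnov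
2010 Thm 2.2 / Conj. 2.4, p. 5 of arXiv:0708.0039), i.e. limit ∝ q with q^3 = ψ'/ψ = πΦ'.

DEFINITION REQUESTS. LocalParafermionicTemplate (topic
Summits/CriticalPhenomena/CardyFormulaZ2/Theorems): the structure (r, m, z, s, g) + its observable
G_D(x,i) and window predicate, so that the four long signatures can be restated over one definition;
filed after open with
`ledger workitem add --kind definition`. No Literature fact is a hypothesis of any item (cone:
definitions only — fkInterface,
passageSum, bondPercolation, innerMedialVertices, bondInterfaceIn, ZdDiscretisationFamily,
ConvergesInLawToSLE, IsChordalUniformizing; since rev 9 no Literature @[conjecture] constant either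
— the SLE₆ conjecture is the inlined item SLE6InterfaceLimit).

Novelty: Searches (2026-08-15): `lit frontier CriticalPhenomena --since 2020` (30 rows; none on exact lattice
holomorphicity at q=1);
`lit related arxiv:1302.4649` / `lit citing arxiv:1302.4649` (30 + 20 rows: arXiv:1612.03666,
1409.8590, 1210.5036, 1202.6265, 1207.3883,
0810.5037 read/skimmed); `lit read arxiv:1302.4649` §4.1.2–4.1.3, §9 (read); `lit read
arxiv:1612.03666` §7 (read); `lit read
arxiv:0708.0039` Thm 2.2 / Conj 2.4 (read); `lit search --source s2 "discrete holomorphicity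
conserved currents loop models quantum affine"`
(7 rows, IWWZJ only relevant); local lit search daemon and galaxy unavailable/saturated this session
(noted), arXiv/OpenAlex/S2 rate-limited;
the card's own audit (zbMATH x4, IWWZJ/dGNP/IW17/DFM texts) is inherited.
Nearest prior art found: IkhlefWestonWheelerZinnJustin2013 (currents ⇒ half-CR; §9 dual equation
missing), IkhlefWeston2017 (§7: fully
discretely-holomorphic operators "remains open"), BondesanEtAl2015 (arXiv:1409.8590: local lattice
currents chiral only in the continuum
limit, numerically), IkhlefCardy2009 / AlamBatchelor2014 (solving linear holomorphicity conditions
for Boltzmann WEIGHTS, not for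
observables at fixed weights), Zhou2024SLE6BondZ2 (approximate second identity, unrefereed), barrier
FKParafermionicHalfCauchyRiemann.
Delta: poses — and types in Lean over the library's interface/winding/percolation objects — the
existence of a second exact relation as a
per-range decidable classification over all finite-range winding-class template  [refs: 1302.4649, 1612.03666, 0708.0039, 1409.8590, arxiv:1302.4649, arxiv:1612.03666, arxiv:0708.0039, IkhlefWestonWheelerZinnJustin2013, IkhlefWeston2017, BondesanEtAl2015, IkhlefCardy2009, AlamBatchelor2014]

Barriers (technique_class: current-classification discrete-holomorphicity census): - technique_class: current-classification discrete-holomorphicity census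
- Literature.Barriers.CriticalPhenomena.FKParafermionicHalfCauchyRiemann: the route sits exactly on
it and is honest: the barrier's class is `halfCRSolutions D c` (vertex relations + boundary values
only) and it proves under-determination; DualCurrentTemplate asks for a SECOND exact relation from a
template outside that class (local corrections × all winding classes), which is evasion by
construction if it exists, while NoDualCurrentRangeZero / NoDualCurrentRangeOne EXTEND the barrier
from Smirnov's one observable to every template of range ≤ 1 — the "no theorem that NO other exact
relation exists at q = 1" gap its scope caveat names.
- Literature.Barriers.CriticalPhenomena.SmirnovTriangularOnly: not triggered — no colour switching,
no harmonic triple, no ψ(e); a positive r2 would be that barrier's evasion route (v) (exact discrete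
holomorphicity from a different observable), a negative r3 says nothing about it.
- Literature.Barriers.CriticalPhenomena.EmbeddingModulusUniqueness: evaded — every input is
embedding-specific (exact identities of the isotropic p = 1/2 square embedding, winding phases of
the actual medial lattice), i.e. the barrier's evasion (i) "an exact lattice symmetry/identity which
pins α"; nothing here is shear-invariant.
- Literature.Barriers.CriticalPhenomena.NienhuisWeightsExcludeVertexSAW: not an obstruction here —
it concerns the UNIFORM self-avoiding walk on Z^2, whose weights are

History (route lifecycle, newest last):
- 2026-08-15T16:23:17Z · rev 4: restated CanonicalLimitFromExactCR (stmt-CriticalPhenomena-7329), NoDualCurrentRangeOne (stmt-CriticalPhenomena-6996), NoDualCurrentRangeZero (stmt-CriticalPhenomena-7145), Assembly (stmt-CriticalPhenomena-5814) — repair: DualCurrentTemplate (stmt-6949) refuted-MISSTATED by Theorems.CardyDualCurrentDualCurrentTe (planner-rrefute-CriticalPhenomena-CardyDualCur-fe2fa0f1-g4-0)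
- 2026-08-15T16:23:17Z · rev 4: dropped stmt-CriticalPhenomena-6949 — repair: DualCurrentTemplate (stmt-6949) refuted-MISSTATED by Theorems.CardyDualCurrentDualCurrentTemplate_refuted (junk SimpleGraph.dist = 0 put the non-edge s( (planner-rrefute-CriticalPhenomena-CardyDualCur-fe2fa0f1-g4-0)
- 2026-08-15T16:23:17Z · REPAIRED (restate CanonicalLimitFromExactCR, NoDualCurrentRangeOne, NoDualCurrentRangeZero, Assembly; drop stmt-CriticalPhenomena-) — back to open: repair: DualCurrentTemplate (stmt-6949) refuted-MISSTATED by Theorems.CardyDualCurrentDualCurrentTemplate_refuted (junk SimpleGraph.dist = 0 put the non-edge s( (planner-rrefute-CriticalPhenomena-CardyDualCur-fe2fa0f1-g4-0)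
- 2026-08-15T16:30:10Z · rev 5: restated DualCurrentTemplateR (stmt-CriticalPhenomena-10759), CanonicalLimitFromExactCR (stmt-CriticalPhenomena-10755), NoDualCurrentRangeOne (stmt-CriticalPhenomena-10756), NoDualCurrentRangeZero (stmt-CriticalPhenomena-10757) — rev 5 (same repair seat): (i) non-degeneracy of DualCurrentTemplateR / NoDualCurren (planner-rrefute-CriticalPhenomena-CardyDualCur-fe2fa0f1-g4-0)
- 2026-08-15T16:30:10Z · rev 5: dropped stmt-CriticalPhenomena-10859 — rev 5 (same repair seat): (i) non-degeneracy of DualCurrentTemplateR / NoDualCurrentRangeOne / NoDualCurrentRangeZero (+ the antecedent of CanonicalLimitFromExa (planner-rrefute-CriticalPhenomena-CardyDualCur-fe2fa0f1-g4-0)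
- 2026-08-15T16:53:30Z · rev 5: dropped stmt-CriticalPhenomena-10859 — RECOVERY of the half-applied rev-5 edit of 16:30:10Z (gate answered 'Lean farm unavailable — edit NOT applied, nothing recorded' but DID retire stmt-10759/10755 (planner-rrefute-CriticalPhenomena-CardyDualCur-fe2fa0f1-g4-0)
- 2026-08-15T16:58:59Z · rev 7: dropped stmt-CriticalPhenomena-0696 — staffable fix step 1/2: detach the decl-less attachment of the shared conjecture item stmt-CriticalPhenomena-0696 (rendered under the foreign name CardyRotToCon (planner-rrefute-CriticalPhenomena-CardyDualCur-fe2fa0f1-g4-0)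
- 2026-08-15T17:35:20Z · rev 9: restated TemplateCanonicalLimit (stmt-CriticalPhenomena-5812), CanonicalLimitFromExactCR (stmt-CriticalPhenomena-11203), MartingaleToSLE6 (stmt-CriticalPhenomena-7604), SLE6LimitZ2 (stmt-CriticalPhenomena-11324), SLE6ToCardy (stmt-CriticalPhenomena-0697) — rev 9 (route-repair seat g5; the refuted-misstated repai (planner-rrefute-CriticalPhenomena-CardyDualCur-fe2fa0f1-g5-0)

sub-problem: CardyFormulaZ2 · status: open · opened planner-plancard-CriticalPhenomena-CardyFormu-d3fc74ab-0 2026-08-15T11:42:45Z · rev 9 · ledger route-CriticalPhenomena-CardyDualCurrent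
GENERATED by the gate from the ledger (D-0016/17). Provers cite these decls: `theorem foo : Summit.CriticalPhenomena.CardyFormulaZ2.Theses.CardyDualCurrent.<Decl> := …` in Summits/CriticalPhenomena/CardyFormulaZ2/Theorems/<Name>.lean.
-/

namespace Summit.CriticalPhenomena.CardyFormulaZ2.Theses.CardyDualCurrent

open scoped BigOperators Topology Manifold Classical MeasureTheory ProbabilityTheory Matrix InnerProductSpace ComplexConjugate ContinuousMap
open Filter Set Function TopologicalSpace MeasureTheory

attribute [summit_statement] _root_.CardyFormulaZ2

-- earlier DualCurrentTemplateR (stmt-CriticalPhenomena-10759, replaced 2026-08-15T16:30:10Z -> stmt-CriticalPhenomena-10929): retired by None — ∃ (r m : ℕ) (z : Fin 2 → Fin m → Literature.Probability.LatticeModels.MedialVertex) (s : Fin 2 → Fin m → ℝ) (g : Fin 2 → Fin m → Set Literature.Probability.LatticeModels.MedialVertex → ℂ), (∀ i k, Literature.Probability.LatticeModels.medialGraph.edist s((0 :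
/-- item stmt-CriticalPhenomena-11201 · crux · rank 2 · open · by planner
why it might fail: Prior is NO: each Bernard–Felder current yields ONE continuity equation (IWWZJ13 §9 'the dual equation is missing'; IW17 §7 still open); the q=2 second relation is a free-fermion argument constraint absent at σ=1/3; Zhou2024 (96) is only O((δ/d)²); deep edist windows make CR bite at every stencil.
sources: IkhlefWestonWheelerZinnJustin2013, IkhlefWeston2017, DuminilCopinSmirnov2012Lattice, DuminilCopin2012Parafermion, Smirnov2010, Zhou2024SLE6BondZ2
[crux] REPAIRED DualCurrentTemplate (stmt-CriticalPhenomena-6949 was refuted-MISSTATED by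
Summit.CriticalPhenomena.CardyFormulaZ2.Theorems.CardyDualCurrentDualCurrentTemplate_refuted:
Mathlib's junk `SimpleGraph.dist = 0` on unreachable pairs put the isolated non-edge pair s(0,0)
into every window, so no window was ever interior, the Cauchy–Riemann clauses were vacuous and the
non-degeneracy clause read ¬True). Repair = the missing normalisation of DISTANCE: every ball/window
is measured with the reachability-aware `medialGraph.edist : ℕ∞` (= ⊤ off the component of the base
edge s(0,e_i)), so passage vertices z_ik, local patterns cfg ∩ B_r and windows range over genuine
lattice edges within medial distance r only; the refuter's witness has edist = ⊤ (planner
Sketch.lean: `diag_not_mem_window`, `base_mem_window`, rc0). Content otherwise unchanged — X itself: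
some finite-range LOCAL PARAFERMIONIC TEMPLATE (finite sum over k of a local weight g_ik of the
percolation configuration seen in the medial ball B_r(x+e_i-edge) times the winding phase passageSum
with free real spin s_ik of the exploration interface fkInterface at the medial vertex x+z_ik, z_ik
∈ B_r) has a p = 1/2 bond-percola -/
@[route_item "route-CriticalPhenomena-CardyDualCurrent", crux]
def DualCurrentTemplateR : Prop :=
  ∃ (r m : ℕ) (z : Fin 2 → Fin m → Literature.Probability.LatticeModels.MedialVertex) (s : Fin 2 → Fin m → ℝ) (g : Fin 2 → Fin m → Set Literature.Probability.LatticeModels.MedialVertex → ℂ), (∀ i k, Literature.Probability.LatticeModels.medialGraph.edist s((0 : Literature.Probability.LatticeModels.Site 2), Pi.single i 1) (z i k) ≤ (r : ℕ∞)) ∧ (let G : Literature.Probability.LatticeModels.DiscreteDobrushin → Literature.Probability.LatticeModels.Site 2 → Fin 2 → ℂ := fun D x i => ∫ cfg, (∑ k, g i k {e | Literature.Probability.LatticeModels.medialGraph.edist s((0 : Literature.Probability.LatticeModels.Site 2), Pi.single i 1) e ≤ (r : ℕ∞) ∧ Sym2.map (· + x) e ∈ cfg} * Literature.Probability.LatticeModels.passageSum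 (Literature.Probability.LatticeModels.fkInterface D cfg) D.δ (s i k) (Sym2.map (· + x) (z i k))) ∂(Literature.Probability.Percolation.bondPercolation (Literature.Probability.LatticeModels.zdGraph 2) Literature.Probability.Percolation.half); let W : Literature.Probability.LatticeModels.DiscreteDobrushin → Literature.Probability.LatticeModels.Site 2 → Fin 2 → ℕ → Prop := fun D x i ρ => ∀ e, Literature.Probability.LatticeModels.medialGraph.edist s((0 : Literature.Probability.LatticeModels.Site 2), Pi.single i 1) e ≤ (ρ : ℕ∞) → Sym2.map (· + x) e ∈ D.innerMedialVertices; (∀ D : Literature.Probability.LatticeModels.DiscreteDobrushin, D.IsZdAdmissible → ((Literature.Probability.LatticeModels.discreteDomainGraph D.Ω D.δ).induce D.zdArcA).Preconnected → (∀ x, W D x 0 r → W D x 1 r → W D (x - Pi.single 0 1) 0 r → W D (x - Pi.single 1 1) 1 r → G D x 1 - G D (x - Pi.single 1 1) 1 = Complex.I * (G D x 0 - G D (x - Pi.single 0 1) 0)) ∧ (∀ f, W D f 0 r → W D (f + Pi.single 1 1) 0 r → W D f 1 r → W D (f + Pi.single 0 1) 1 r → G D (f + Pi.single 1 1) 0 -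 G D f 0 = Complex.I * (G D (f + Pi.single 0 1) 1 - G D f 1))) ∧ ¬ (∀ D : Literature.Probability.LatticeModels.DiscreteDobrushin, D.IsZdAdmissible → ((Literature.Probability.LatticeModels.discreteDomainGraph D.Ω D.δ).induce D.zdArcA).Preconnected → ∀ x x' i, W D x i (r + 2) → W D x' i (r + 2) → G D x i = G D x' i))

-- earlier NoDualCurrentRangeOne (stmt-CriticalPhenomena-10756, replaced 2026-08-15T16:30:10Z -> stmt-CriticalPhenomena-10931): retired by None — ¬ ∃ (m : ℕ) (z : Fin 2 → Fin m → Literature.Probability.LatticeModels.MedialVertex) (n : Fin 2 → Fin m → ℤ) (g : Fin 2 → Fin m → Set Literature.Probability.LatticeModels.MedialVertex → ℂ), (∀ i k, Literature.Probability.LatticeModels.medialGraph.edist s((0 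
-- earlier NoDualCurrentRangeOne (stmt-CriticalPhenomena-5809, replaced 2026-08-15T11:59:21Z -> stmt-CriticalPhenomena-6996): retired by None — ¬ ∃ (m : ℕ) (z : Fin 2 → Fin m → Literature.Probability.LatticeModels.MedialVertex) (n : Fin 2 → Fin m → ℤ) (g : Fin 2 → Fin m → Set Literature.Probability.LatticeModels.MedialVertex → ℂ), (∀ i k, Literature.Probability.LatticeModels.medialGraph.dist s((0 : L
-- earlier NoDualCurrentRangeOne (stmt-CriticalPhenomena-6996, replaced 2026-08-15T16:23:17Z -> stmt-CriticalPhenomena-10756): retired by None — ¬ ∃ (m : ℕ) (z : Fin 2 → Fin m → Literature.Probability.LatticeModels.MedialVertex) (n : Fin 2 → Fin m → ℤ) (g : Fin 2 → Fin m → Set Literature.Probability.LatticeModels.MedialVertex → ℂ), (∀ i k, Literature.Probability.LatticeModels.medialGraph.dist s((0 : 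
/-- item stmt-CriticalPhenomena-11202 · crux · rank 3 · open · by planner
why it might fail: False exactly if the positive branch already wins at medial range 1; a proof must kill EVERY range-1 template in SOME admissible domain or show all-domain degeneracy (local-sufficiency lemma, not in print) via exact expectations on ≥5×5 Dobrushin boxes (~2^40 configs) — certificate may not fit Lean.
sources: DuminilCopin2013Parafermion, IkhlefCardy2009, AlamBatchelor2014, BondesanEtAl2015, Literature.Barriers.CriticalPhenomena.FKParafermionicHalfCauchyRiemann
[crux] RESTATED 2026-08-15 to reachability-aware balls (`medialGraph.edist ≤ 1`: the base edge and
its four medial neighbours; the earlier `dist` typing stmt-6996 was vacuously TRUE by the junk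
exploited in
Summit.CriticalPhenomena.CardyFormulaZ2.Theorems.CardyDualCurrentDualCurrentTemplate_refuted, so a
'proof' of it would have been worthless). Negative side at medial range ≤ 1: no template whose
passage vertices and local configuration factor live in the medial ball of radius 1 (5 genuine
edges) and whose windings are read modulo 6π (spins n/3, phases 24th roots of unity since windingAt
∈ (π/4)ℤ) is exactly CR (vertex and face Duffin relations at every stencil with four interior
radius-1 windows) and non-degenerate between deep windows (radius 1+2 = 3 interior balls around the
two witnesses, so every demanded CR equation touching them is in force; rev 5, matching
DualCurrentTemplateR) in all admissible domains with preconnected wired arc — a finite linear system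
over Q(ζ24) (≈ 2·5·12·32 unknowns) to be killed by exact expectations on small admissible Dobrushin
boxes (LatticeDobrushinBox.lean supplies threeSided W H / barDomain with computed arcs and
isZdAdmissible_*, preconnected -/
@[route_item "route-CriticalPhenomena-CardyDualCurrent"]
def NoDualCurrentRangeOne : Prop :=
  ¬ ∃ (m : ℕ) (z : Fin 2 → Fin m → Literature.Probability.LatticeModels.MedialVertex) (n : Fin 2 → Fin m → ℤ) (g : Fin 2 → Fin m → Set Literature.Probability.LatticeModels.MedialVertex → ℂ), (∀ i k, Literature.Probability.LatticeModels.medialGraph.edist s((0 : Literature.Probability.LatticeModels.Site 2), Pi.single i 1) (z i k) ≤ (1 : ℕ∞)) ∧ (let G : Literature.Probability.LatticeModels.DiscreteDobrushin → Literature.Probability.LatticeModels.Site 2 → Fin 2 → ℂ := fun D x i => ∫ cfg, (∑ k, g i k {e | Literature.Probability.LatticeModels.medialGraph.edist s((0 : Literature.Probability.LatticeModels.Site 2), Pi.single i 1) e ≤ (1 : ℕ∞) ∧ Sym2.map (· + x) e ∈ cfg} * Literature.Probability.LatticeModels.passageSum (Literature.Probability.LatticeModels.fkInterface D cfg) D.δ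 ((n i k : ℝ) / 3) (Sym2.map (· + x) (z i k))) ∂(Literature.Probability.Percolation.bondPercolation (Literature.Probability.LatticeModels.zdGraph 2) Literature.Probability.Percolation.half); let W : Literature.Probability.LatticeModels.DiscreteDobrushin → Literature.Probability.LatticeModels.Site 2 → Fin 2 → ℕ → Prop := fun D x i ρ => ∀ e, Literature.Probability.LatticeModels.medialGraph.edist s((0 : Literature.Probability.LatticeModels.Site 2), Pi.single i 1) e ≤ (ρ : ℕ∞) → Sym2.map (· + x) e ∈ D.innerMedialVertices; (∀ D : Literature.Probability.LatticeModels.DiscreteDobrushin, D.IsZdAdmissible → ((Literature.Probability.LatticeModels.discreteDomainGraph D.Ω D.δ).induce D.zdArcA).Preconnected → (∀ x, W D x 0 1 → W D x 1 1 → W D (x - Pi.single 0 1) 0 1 → W D (x - Pi.single 1 1) 1 1 → G D x 1 - G D (x - Pi.single 1 1) 1 = Complex.I * (G D x 0 - G D (x - Pi.single 0 1) 0)) ∧ (∀ f, W D f 0 1 → W D (f + Pi.single 1 1) 0 1 → W D f 1 1 → W D (f + Pi.single 0 1) 1 1 → G D (f + Pi.single 1 1) 0 - G D f 0 = Complex.I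 * (G D (f + Pi.single 0 1) 1 - G D f 1))) ∧ ¬ (∀ D : Literature.Probability.LatticeModels.DiscreteDobrushin, D.IsZdAdmissible → ((Literature.Probability.LatticeModels.discreteDomainGraph D.Ω D.δ).induce D.zdArcA).Preconnected → ∀ x x' i, W D x i 3 → W D x' i 3 → G D x i = G D x' i))

-- earlier CanonicalLimitFromExactCR (stmt-CriticalPhenomena-10755, replaced 2026-08-15T16:30:10Z -> stmt-CriticalPhenomena-10930): retired by None — (∃ (r m : ℕ) (z : Fin 2 → Fin m → Literature.Probability.LatticeModels.MedialVertex) (s : Fin 2 → Fin m → ℝ) (g : Fin 2 → Fin m → Set Literature.Probability.LatticeModels.MedialVertex → ℂ), (∀ i k, Literature.Probability.LatticeModels.medialGraph.edist 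
-- earlier CanonicalLimitFromExactCR (stmt-CriticalPhenomena-11203, replaced 2026-08-15T17:35:20Z -> stmt-CriticalPhenomena-11394): retired by None — (∃ (r m : ℕ) (z : Fin 2 → Fin m → Literature.Probability.LatticeModels.MedialVertex) (s : Fin 2 → Fin m → ℝ) (g : Fin 2 → Fin m → Set Literature.Probability.LatticeModels.MedialVertex → ℂ), (∀ i k, Literature.Probability.LatticeModels.medialGraph.edist 
-- earlier CanonicalLimitFromExactCR (stmt-CriticalPhenomena-5810, replaced 2026-08-15T12:08:11Z -> stmt-CriticalPhenomena-7329): retired by None — DualCurrentTemplate → TemplateCanonicalLimit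
-- earlier CanonicalLimitFromExactCR (stmt-CriticalPhenomena-7329, replaced 2026-08-15T16:23:17Z -> stmt-CriticalPhenomena-10755): retired by None — (∃ (r m : ℕ) (z : Fin 2 → Fin m → Literature.Probability.LatticeModels.MedialVertex) (s : Fin 2 → Fin m → ℝ) (g : Fin 2 → Fin m → Set Literature.Probability.LatticeModels.MedialVertex → ℂ), (∀ i k, Literature.Probability.LatticeModels.medialGraph.dist s(
/-- item stmt-CriticalPhenomena-11394 · crux · rank 4 · open · by planner
why it might fail: Even with full CR the spin-1/3 Riemann BVP lacks Smirnov's integrable primitive Im∫F² (σ=1/2-specific; one needs Im∫F³dz discretely); CR is not demanded in the width-r boundary layer, where RSW must control the defect; a corrected template's boundary values are not a priori Smirnov's.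
sources: Smirnov2010, ChelkakSmirnov2012, DuminilCopinSmirnov2012Lattice, KemppainenSmirnov2017
[crux] RESTATED 2026-08-15 (rev 9): consequent = the FAMILY version of TemplateCanonicalLimit
(verbatim its body), antecedent = verbatim the body of DualCurrentTemplateR (unchanged; edist
windows, deep-window non-degeneracy). Exact discrete holomorphicity forces the canonical scaling
limit along every admissible square-lattice discretisation family: from any witness of
DualCurrentTemplateR (the witness may be re-chosen / renormalised at finite range near the boundary)
one gets a local template and C > 0 whose observable satisfies Smirnov 2010 Thm 2.2 at σ = 1/3 —
θ_δ·C·δ^(-1/3)·G_{E δ} → q, q^3 = ψ'/ψ, locally uniformly on D, for every Dobrushin domain D, every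
ZdDiscretisationFamily E of D and every chordal uniformizer φ (inverse ψ). Expected proof shape:
discrete CR ⇒ discrete Cauchy/Morera and precompactness (Harnack-type estimates for exactly CR
templates; RSW in the width-r boundary layer where CR is not demanded) ⇒ subsequential limits
holomorphic with the spin-1/3 Riemann boundary values Im(f·tangent^(1/3)) = 0 ⇒ f = C(πΦ')^(1/3) by
uniqueness of the Riemann–Hilbert problem (Smirnov 2010 §2, Rem 2.3: the BVP solution is
Carathéodory-continuous in the domain). [deps: DualCurr -/
@[route_item "route-CriticalPhenomena-CardyDualCurrent", crux]
def CanonicalLimitFromExactCR : Prop :=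
  (∃ (r m : ℕ) (z : Fin 2 → Fin m → Literature.Probability.LatticeModels.MedialVertex) (s : Fin 2 → Fin m → ℝ) (g : Fin 2 → Fin m → Set Literature.Probability.LatticeModels.MedialVertex → ℂ), (∀ i k, Literature.Probability.LatticeModels.medialGraph.edist s((0 : Literature.Probability.LatticeModels.Site 2), Pi.single i 1) (z i k) ≤ (r : ℕ∞)) ∧ (let G : Literature.Probability.LatticeModels.DiscreteDobrushin → Literature.Probability.LatticeModels.Site 2 → Fin 2 → ℂ := fun D x i => ∫ cfg, (∑ k, g i k {e | Literature.Probability.LatticeModels.medialGraph.edist s((0 : Literature.Probability.LatticeModels.Site 2), Pi.single i 1) e ≤ (r : ℕ∞) ∧ Sym2.map (· + x) e ∈ cfg} * Literature.Probability.LatticeModels.passageSum (Literature.Probability.LatticeModels.fkInterface D cfg) D.δ (s i k) (Sym2.map (· + x) (z i k))) ∂(Literature.Probability.Percolation.bondPercolation (Literature.Probability.LatticeModels.zdGraph 2) Literature.Probability.Percolation.half); let W : Literature.Probability.LatticeModels.DiscreteDobrushin → Literature.Probability.LatticeModels.Site 2 → Fin 2 → ℕ → Prop := fun D x i ρ =>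 ∀ e, Literature.Probability.LatticeModels.medialGraph.edist s((0 : Literature.Probability.LatticeModels.Site 2), Pi.single i 1) e ≤ (ρ : ℕ∞) → Sym2.map (· + x) e ∈ D.innerMedialVertices; (∀ D : Literature.Probability.LatticeModels.DiscreteDobrushin, D.IsZdAdmissible → ((Literature.Probability.LatticeModels.discreteDomainGraph D.Ω D.δ).induce D.zdArcA).Preconnected → (∀ x, W D x 0 r → W D x 1 r → W D (x - Pi.single 0 1) 0 r → W D (x - Pi.single 1 1) 1 r → G D x 1 - G D (x - Pi.single 1 1) 1 = Complex.I * (G D x 0 - G D (x - Pi.single 0 1) 0)) ∧ (∀ f, W D f 0 r → W D (f + Pi.single 1 1) 0 r → W D f 1 r → W D (f + Pi.single 0 1) 1 r → G D (f + Pi.single 1 1) 0 - G D f 0 = Complex.I * (G D (f + Pi.single 0 1) 1 - G D f 1))) ∧ ¬ (∀ D : Literature.Probability.LatticeModels.DiscreteDobrushin, D.IsZdAdmissible → ((Literature.Probability.LatticeModels.discreteDomainGraph D.Ω D.δ).induce D.zdArcA).Preconnected → ∀ x x' i, W D x i (r + 2) → W D x' i (r + 2) → G D x i = G D x' i))) →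 (∃ (r m : ℕ) (z : Fin 2 → Fin m → Literature.Probability.LatticeModels.MedialVertex) (s : Fin 2 → Fin m → ℝ) (g : Fin 2 → Fin m → Set Literature.Probability.LatticeModels.MedialVertex → ℂ) (C : ℝ), 0 < C ∧ (∀ i k, Literature.Probability.LatticeModels.medialGraph.edist s((0 : Literature.Probability.LatticeModels.Site 2), Pi.single i 1) (z i k) ≤ (r : ℕ∞)) ∧ (let G : Literature.Probability.LatticeModels.DiscreteDobrushin → Literature.Probability.LatticeModels.Site 2 → Fin 2 → ℂ := fun D x i => ∫ cfg, (∑ k, g i k {e | Literature.Probability.LatticeModels.medialGraph.edist s((0 : Literature.Probability.LatticeModels.Site 2), Pi.single i 1) e ≤ (r : ℕ∞) ∧ Sym2.map (· + x) e ∈ cfg} * Literature.Probability.LatticeModels.passageSum (Literature.Probability.LatticeModels.fkInterface D cfg) D.δ (s i k) (Sym2.map (· + x) (z i k))) ∂(Literature.Probability.Percolation.bondPercolation (Literature.Probability.LatticeModels.zdGraph 2) Literature.Probability.Percolation.half); ∀ (D : Literature.Probability.RandomPlanarGeometry.DobrushinDomain) (E : ℝ → Literature.Probability.LatticeModels.DiscreteDobrushin),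 Literature.Probability.LatticeModels.ZdDiscretisationFamily D E → ∀ (φ : Literature.Probability.RandomPlanarGeometry.ConformalEquiv UpperHalfPlane.upperHalfPlaneSet D.carrier), D.IsChordalUniformizing φ → ∀ q : ℂ → ℂ, DifferentiableOn ℂ q D.carrier → (∀ w ∈ D.carrier, q w ^ 3 = deriv φ.symm w / φ.symm w) → ∃ θ : ℝ → ℂ, (∀ δ, ‖θ δ‖ = 1) ∧ ∀ i : Fin 2, TendstoLocallyUniformlyOn (fun (δ : ℝ) (w : ℂ) => θ δ * C * ((δ ^ (-(1 / 3 : ℝ)) : ℝ) : ℂ) * G (E δ) (fun j => ⌊(if j = 0 then w.re else w.im) / δ⌋) i) q (𝓝[>] (0 : ℝ)) D.carrier))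

-- earlier MartingaleToSLE6 (stmt-CriticalPhenomena-5811, replaced 2026-08-15T12:12:46Z -> stmt-CriticalPhenomena-7604): retired by None — TemplateCanonicalLimit → Literature.Probability.Percolation.SLE6LimitZ2
-- earlier MartingaleToSLE6 (stmt-CriticalPhenomena-7604, replaced 2026-08-15T17:35:20Z -> stmt-CriticalPhenomena-11395): retired by None — (∃ (r m : ℕ) (z : Fin 2 → Fin m → Literature.Probability.LatticeModels.MedialVertex) (s : Fin 2 → Fin m → ℝ) (g : Fin 2 → Fin m → Set Literature.Probability.LatticeModels.MedialVertex → ℂ) (c : ℂ), c ≠ 0 ∧ (∀ i k, Literature.Probability.LatticeModels.medialGraph.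
/-- item stmt-CriticalPhenomena-11395 · crux · rank 5 · open · by planner
why it might fail: Identification reads the observable in random rough slit domains: needs Carathéodory-uniform convergence (Smirnov2010 Rem 2.3, KS17 §4), more than the per-family antecedent literally gives; the local factor must be domain-Markov compatible; tightness for general families E is not yet in tree.
sources: KemppainenSmirnov2017, Smirnov2010, CDHKSCRAS2014, DuminilCopinSmirnov2012Lattice, CamiaNewman2007, LawlerSchrammWerner2001
[crux] RESTATED 2026-08-15 (rev 9): TemplateCanonicalLimit (family version, verbatim its body) →
SLE6InterfaceLimit (verbatim its body = the all-discretisations form of Smirnov's ICM 2006 Conj. 4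
at q = 1, the item shared by signature with CardyViaSLE6 / CardyRotToConf, stmt-11283), replacing `…
→ Literature SLE6LimitZ2` (canonical data behind a generically vacuous admissibility guard; and a
Literature @[conjecture] constant may sit in a route's cone only as the route's own item text).
Content: a local template observable with the canonical spin-1/3 limit along every admissible
discretisation family is a martingale observable of the exploration (domain Markov property of
percolation: given γ[0,n] the rest of the interface is the interface of the slit data (Ω_δ minus
γ[0,n]; γ(n), b), again admissible discrete Dobrushin data) and identifies every subsequential limit
of the interface bondInterfaceIn D (E δ), along every ZdDiscretisationFamily E, as chordal SLE₆ —
tightness from RSW + Aizenman–Burchard (in tree for the canonical data: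
isTightLaws_map_bondInterface), κ = 6 from the Itô computation with exponent 1/3; the q = 1 twin of
the Literature FK-Ising chain (FKIsingDrivingMarting -/
@[route_item "route-CriticalPhenomena-CardyDualCurrent", crux]
def MartingaleToSLE6 : Prop :=
  (∃ (r m : ℕ) (z : Fin 2 → Fin m → Literature.Probability.LatticeModels.MedialVertex) (s : Fin 2 → Fin m → ℝ) (g : Fin 2 → Fin m → Set Literature.Probability.LatticeModels.MedialVertex → ℂ) (C : ℝ), 0 < C ∧ (∀ i k, Literature.Probability.LatticeModels.medialGraph.edist s((0 : Literature.Probability.LatticeModels.Site 2), Pi.single i 1) (z i k) ≤ (r : ℕ∞)) ∧ (let G : Literature.Probability.LatticeModels.DiscreteDobrushin → Literature.Probability.LatticeModels.Site 2 → Fin 2 → ℂ := fun D x i => ∫ cfg, (∑ k, g i k {e | Literature.Probability.LatticeModels.medialGraph.edist s((0 : Literature.Probability.LatticeModels.Site 2), Pi.single i 1) e ≤ (r : ℕ∞) ∧ Sym2.map (· + x) e ∈ cfg} * Literature.Probability.LatticeModels.passageSum (Literature.Probability.LatticeModels.fkInterface D cfg) D.δ (s i k) (Sym2.map (· + x) (z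 i k))) ∂(Literature.Probability.Percolation.bondPercolation (Literature.Probability.LatticeModels.zdGraph 2) Literature.Probability.Percolation.half); ∀ (D : Literature.Probability.RandomPlanarGeometry.DobrushinDomain) (E : ℝ → Literature.Probability.LatticeModels.DiscreteDobrushin), Literature.Probability.LatticeModels.ZdDiscretisationFamily D E → ∀ (φ : Literature.Probability.RandomPlanarGeometry.ConformalEquiv UpperHalfPlane.upperHalfPlaneSet D.carrier), D.IsChordalUniformizing φ → ∀ q : ℂ → ℂ, DifferentiableOn ℂ q D.carrier → (∀ w ∈ D.carrier, q w ^ 3 = deriv φ.symm w / φ.symm w) → ∃ θ : ℝ → ℂ, (∀ δ, ‖θ δ‖ = 1) ∧ ∀ i : Fin 2, TendstoLocallyUniformlyOn (fun (δ : ℝ) (w : ℂ) => θ δ * C * ((δ ^ (-(1 / 3 : ℝ)) : ℝ) : ℂ) * G (E δ) (fun j => ⌊(if j = 0 then w.re else w.im) / δ⌋) i) q (𝓝[>] (0 : ℝ)) D.carrier)) → (∀ (D : Literature.Probability.RandomPlanarGeometry.DobrushinDomain) (E : ℝ → Literature.Probability.LatticeModels.DiscreteDobrushin), Literature.Probability.LatticeModels.ZdDiscretisationFamily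 D E → Literature.Probability.RandomPlanarGeometry.ConvergesInLawToSLE 6 D (Ωδ := fun _ => Literature.Probability.Percolation.BondConfig (Literature.Probability.LatticeModels.Site 2)) (fun δ => Literature.Probability.Percolation.bondInterfaceIn D (E δ)) (fun _ => Literature.Probability.Percolation.bondPercolation (Literature.Probability.LatticeModels.zdGraph 2) Literature.Probability.Percolation.half))

/-- item stmt-CriticalPhenomena-11283 · crux · rank 6 · open · by planner
why it might fail: Open (Smirnov2007ICM Conj. 4, q = 1): false if ℤ² subsequential limits are non-unique or only similarity-covariant (anisotropy surviving, cf. EmbeddingModulusUniqueness); reachable here only through the open r2→r4→r5; unrefereed contrary claim arXiv:2206.04599 vs arXiv:2409.03235.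
sources: Smirnov2007ICM, Schramm2007ICM, CamiaNewman2007, DKKMO2020Rotational
[target] X_C1, all-discretisations form (Smirnov2007ICM §2.3 Conj. 4 at q = 1; = the body of
Literature.Probability.Percolation.SLE6LimitZ2AllDiscretisations, restated verbatim so that the open
conjecture is the route's own target and no cite_only constant sits in the cone; Iff.rfl with the
Literature def checked in the planner Sketch): for every Dobrushin domain (Ω; a, b) and every
admissible square-lattice discretisation family E (ZdDiscretisationFamily D E: meshDomain Ω δ, free
arcs → (ab), (ba), discrete marks → {a, b}, IsZdAdmissible eventually) the medial exploration
interface bondInterfaceIn D (E δ) of P_{1/2} bond percolation converges in law in CurveClass ℂ to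
chordal SLE₆ in (Ω; a, b) (ConvergesInLawToSLE 6 D). Replaces the canonical-data form SLE6LimitZ2
(vacuous on the unit disc and along δ_k → 0 on axis-aligned rectangles,
InterfaceScalingLimitDiscretised.lean §2). To be reached by symmetry upgrading (R3 +
RotationCovariance + LimitFamily + R2 + LimitGlue), not via Cardy. [difficulty: open-problem]
(successor of stmt-CriticalPhenomena-0696 in this route) -/
@[route_item "route-CriticalPhenomena-CardyDualCurrent"]
def SLE6InterfaceLimit : Prop :=
  ∀ (D : Literature.Probability.RandomPlanarGeometry.DobrushinDomain) (E : ℝ → Literature.Probability.LatticeModels.DiscreteDobrushin), Literature.Probability.LatticeModels.ZdDiscretisationFamily D E → Literature.Probability.RandomPlanarGeometry.ConvergesInLawToSLE 6 D (Ωδ := fun _ => Literature.Probability.Percolation.BondConfig (Literature.Probability.LatticeModels.Site 2)) (fun δ => Literature.Probability.Percolation.bondInterfaceIn D (E δ)) (fun _ => Literature.Probability.Percolation.bondPercolation (Literature.Probability.LatticeModels.zdGraph 2) Literature.Probability.Percolation.half)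

-- earlier SLE6ToCardy (stmt-CriticalPhenomena-0697, replaced 2026-08-15T17:35:20Z -> stmt-CriticalPhenomena-10278): open — Literature.Probability.Percolation.SLE6LimitZ2 → CardyFormulaZ2
/-- item stmt-CriticalPhenomena-10278 · support · rank 9 · closed · proved by Summit.CriticalPhenomena.CardyFormulaZ2.Theorems.cardyRotToConfSLE6ToCardy_proof @ d2e31eec539a (prover) · by planner
sources: CamiaNewman2007, Smirnov2001, Werner2007, LawlerSchrammWerner2001
[support] SLE₆ → Cardy payoff, the body of Literature `SLE6LimitZ2AllDiscretisations` INLINED (so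
the route's cone carries no cite_only open-conjecture constant; mathematically identical to
CardyRotToConf item stmt-CriticalPhenomena-8603 `SLE6LimitZ2AllDiscretisations → CardyFormulaZ2`,
which this route drops): convergence of the exploration interface to chordal SLE₆ for every
Dobrushin domain and every admissible ℤ²-discretisation family implies Cardy's formula for bond-ℤ²
(choose discretisations of (Ω; a, c) aligned with the discrete arcs; crossing = interface hits (cd)
before (bc) up to boundary 3-arm events; portmanteau + sle_six_measureReal_hitsBefore). Sources:
CamiaNewman2007, Smirnov2001, Werner2007, LawlerSchrammWerner2001. Difficulty: L. -/
@[route_item "route-CriticalPhenomena-CardyDualCurrent", crux]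
def SLE6ToCardy : Prop :=
  (∀ (D : Literature.Probability.RandomPlanarGeometry.DobrushinDomain) (E : ℝ → Literature.Probability.LatticeModels.DiscreteDobrushin), Literature.Probability.LatticeModels.ZdDiscretisationFamily D E → Literature.Probability.RandomPlanarGeometry.ConvergesInLawToSLE 6 D (Ωδ := fun _ => Literature.Probability.Percolation.BondConfig (Literature.Probability.LatticeModels.Site 2)) (fun δ => Literature.Probability.Percolation.bondInterfaceIn D (E δ)) (fun _ => Literature.Probability.Percolation.bondPercolation (Literature.Probability.LatticeModels.zdGraph 2) Literature.Probability.Percolation.half)) → CardyFormulaZ2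

-- earlier NoDualCurrentRangeZero (stmt-CriticalPhenomena-10757, replaced 2026-08-15T16:30:10Z -> stmt-CriticalPhenomena-10932): retired by None — ¬ ∃ (m : ℕ) (z : Fin 2 → Fin m → Literature.Probability.LatticeModels.MedialVertex) (n : Fin 2 → Fin m → ℤ) (g : Fin 2 → Fin m → Set Literature.Probability.LatticeModels.MedialVertex → ℂ), (∀ i k, Literature.Probability.LatticeModels.medialGraph.edist s((0
-- earlier NoDualCurrentRangeZero (stmt-CriticalPhenomena-5813, replaced 2026-08-15T12:03:57Z -> stmt-CriticalPhenomena-7145): retired by None — ¬ ∃ (m : ℕ) (z : Fin 2 → Fin m → Literature.Probability.LatticeModels.MedialVertex) (n : Fin 2 → Fin m → ℤ) (g : Fin 2 → Fin m → Set Literature.Probability.LatticeModels.MedialVertex → ℂ), (∀ i k, Literature.Probability.LatticeModels.medialGraph.dist s((0 : 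
-- earlier NoDualCurrentRangeZero (stmt-CriticalPhenomena-7145, replaced 2026-08-15T16:23:17Z -> stmt-CriticalPhenomena-10757): retired by None — ¬ ∃ (m : ℕ) (z : Fin 2 → Fin m → Literature.Probability.LatticeModels.MedialVertex) (n : Fin 2 → Fin m → ℤ) (g : Fin 2 → Fin m → Set Literature.Probability.LatticeModels.MedialVertex → ℂ), (∀ i k, Literature.Probability.LatticeModels.medialGraph.dist s((0 :
/-- item stmt-CriticalPhenomena-11204 · support · rank 9 · open · by planner
sources: DuminilCopin2012Parafermion, Smirnov2010, Summit.CriticalPhenomena.CardyFormulaZ2.Theorems.CardyDualCurrentDualCurrentTemplate_refuted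
[support] RESTATED 2026-08-15 to reachability-aware balls (`medialGraph.edist ≤ 0`, i.e. the base
edge alone; the earlier `dist` typing stmt-7145 was vacuously TRUE by the junk exploited in
Summit.CriticalPhenomena.CardyFormulaZ2.Theorems.CardyDualCurrentDualCurrentTemplate_refuted).
Range-0 warm-up and pipeline validation of the negative side: no reweighting of Smirnov's vertex
observable by the state of the base edge and the winding class (2·12·2 unknowns per edge type; spins
n/3) is exactly CR (vertex + face Duffin relations wherever the four single-edge windows are
interior medial vertices) and non-degenerate between deep windows (radius 0+2 = 2 interior balls
around the two witnesses; rev 5, matching DualCurrentTemplateR) in all admissible domains with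
preconnected wired arc; decidable by brute-force exact enumeration on 4x4–5x5 admissible boxes
(threeSided / barDomain of LatticeDobrushinBox.lean). Difficulty: M. -/
@[route_item "route-CriticalPhenomena-CardyDualCurrent"]
def NoDualCurrentRangeZero : Prop :=
  ¬ ∃ (m : ℕ) (z : Fin 2 → Fin m → Literature.Probability.LatticeModels.MedialVertex) (n : Fin 2 → Fin m → ℤ) (g : Fin 2 → Fin m → Set Literature.Probability.LatticeModels.MedialVertex → ℂ), (∀ i k, Literature.Probability.LatticeModels.medialGraph.edist s((0 : Literature.Probability.LatticeModels.Site 2), Pi.single i 1) (z i k) ≤ (0 : ℕ∞)) ∧ (let G : Literature.Probability.LatticeModels.DiscreteDobrushin → Literature.Probability.LatticeModels.Site 2 → Fin 2 → ℂ := fun D x i => ∫ cfg, (∑ k, g i k {e | Literature.Probability.LatticeModels.medialGraph.edist s((0 : Literature.Probability.LatticeModels.Site 2), Pi.single i 1) e ≤ (0 : ℕ∞) ∧ Sym2.map (· + x) e ∈ cfg} * Literature.Probability.LatticeModels.passageSum (Literature.Probability.LatticeModels.fkInterface D cfg) D.δ ((n i k : ℝ) / 3) (Sym2.map (· + x) (z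 i k))) ∂(Literature.Probability.Percolation.bondPercolation (Literature.Probability.LatticeModels.zdGraph 2) Literature.Probability.Percolation.half); let W : Literature.Probability.LatticeModels.DiscreteDobrushin → Literature.Probability.LatticeModels.Site 2 → Fin 2 → ℕ → Prop := fun D x i ρ => ∀ e, Literature.Probability.LatticeModels.medialGraph.edist s((0 : Literature.Probability.LatticeModels.Site 2), Pi.single i 1) e ≤ (ρ : ℕ∞) → Sym2.map (· + x) e ∈ D.innerMedialVertices; (∀ D : Literature.Probability.LatticeModels.DiscreteDobrushin, D.IsZdAdmissible → ((Literature.Probability.LatticeModels.discreteDomainGraph D.Ω D.δ).induce D.zdArcA).Preconnected → (∀ x, W D x 0 0 → W D x 1 0 → W D (x - Pi.single 0 1) 0 0 → W D (x - Pi.single 1 1) 1 0 → G D x 1 - G D (x - Pi.single 1 1) 1 = Complex.I * (G D x 0 - G D (x - Pi.single 0 1) 0)) ∧ (∀ f, W D f 0 0 → W D (f + Pi.single 1 1) 0 0 → W D f 1 0 → W D (f + Pi.single 0 1) 1 0 → G D (f + Pi.single 1 1) 0 - G D f 0 = Complex.I * (G D (f + Pi.single 0 1) 1 - G D f 1)))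 ∧ ¬ (∀ D : Literature.Probability.LatticeModels.DiscreteDobrushin, D.IsZdAdmissible → ((Literature.Probability.LatticeModels.discreteDomainGraph D.Ω D.δ).induce D.zdArcA).Preconnected → ∀ x x' i, W D x i 2 → W D x' i 2 → G D x i = G D x' i))

-- earlier TemplateCanonicalLimit (stmt-CriticalPhenomena-5812, replaced 2026-08-15T17:35:20Z -> stmt-CriticalPhenomena-11393): retired by None — ∃ (r m : ℕ) (z : Fin 2 → Fin m → Literature.Probability.LatticeModels.MedialVertex) (s : Fin 2 → Fin m → ℝ) (g : Fin 2 → Fin m → Set Literature.Probability.LatticeModels.MedialVertex → ℂ) (c : ℂ), c ≠ 0 ∧ (∀ i k, Literature.Probability.LatticeModels.medialG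
/-- item stmt-CriticalPhenomena-11393 · support · rank 9 · open · by planner
sources: Smirnov2010, DuminilCopinSmirnov2012Lattice, CDHKSCRAS2014
[support] RESTATED 2026-08-15 (rev 9) over square-lattice DISCRETISATION FAMILIES, mirroring the
reviewed σ = 1/2 rendering
Literature.Probability.LatticeModels.fkIsingObservable_tendstoLocallyUniformlyOn_sqrt_deriv_of_isDiscretisation
(Smirnov 2010 Thm 2.2 + Rem 2.3) at σ = 1/3; the earlier canonical-data form (guard `∀ᶠ δ,
(dobrushinData D δ).IsZdAdmissible`) is silent on discs and axis-aligned rectangles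
(CanonicalDiscretisationTies / sle6LimitZ2_unitDisc_vacuous) and is dropped; template balls are
reachability-aware (`medialGraph.edist ≤ r`, as in DualCurrentTemplateR). Statement (DCS Conj. 8.7 /
Smirnov 2010 Conj. 2.4 at q = 1 for SOME finite-range local template): there are a local
parafermionic template (r, m, z, s, g) and a lattice constant C > 0 such that for every Dobrushin
domain (D; a, b), every ZdDiscretisationFamily E of it (Ω_δ = meshDomain D δ, arcs → (ab), (ba),
marks → {a, b}, IsZdAdmissible eventually), every chordal uniformizer φ : (ℍ; 0, ∞) → (D; a, b) with
inverse ψ and every holomorphic branch q of (ψ'/ψ)^(1/3) on D (q = (πΦ')^(1/3), Φ the strip map)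
there are unit phases θ_δ (absorbing the mesh-dependent winding origin) with θ_δ·C·δ^(-1/3)·G_{E
δ}(⌊w/δ⌋, i) -/
@[route_item "route-CriticalPhenomena-CardyDualCurrent", crux]
def TemplateCanonicalLimit : Prop :=
  ∃ (r m : ℕ) (z : Fin 2 → Fin m → Literature.Probability.LatticeModels.MedialVertex) (s : Fin 2 → Fin m → ℝ) (g : Fin 2 → Fin m → Set Literature.Probability.LatticeModels.MedialVertex → ℂ) (C : ℝ), 0 < C ∧ (∀ i k, Literature.Probability.LatticeModels.medialGraph.edist s((0 : Literature.Probability.LatticeModels.Site 2), Pi.single i 1) (z i k) ≤ (r : ℕ∞)) ∧ (let G : Literature.Probability.LatticeModels.DiscreteDobrushin → Literature.Probability.LatticeModels.Site 2 → Fin 2 → ℂ := fun D x i => ∫ cfg, (∑ k, g i k {e | Literature.Probability.LatticeModels.medialGraph.edist s((0 : Literature.Probability.LatticeModels.Site 2), Pi.single i 1) e ≤ (r : ℕ∞) ∧ Sym2.map (· + x) e ∈ cfg} * Literature.Probability.LatticeModels.passageSum (Literature.Probability.LatticeModels.fkInterface D cfg) D.δ (s i k) (Sym2.map (· + x) (z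 i k))) ∂(Literature.Probability.Percolation.bondPercolation (Literature.Probability.LatticeModels.zdGraph 2) Literature.Probability.Percolation.half); ∀ (D : Literature.Probability.RandomPlanarGeometry.DobrushinDomain) (E : ℝ → Literature.Probability.LatticeModels.DiscreteDobrushin), Literature.Probability.LatticeModels.ZdDiscretisationFamily D E → ∀ (φ : Literature.Probability.RandomPlanarGeometry.ConformalEquiv UpperHalfPlane.upperHalfPlaneSet D.carrier), D.IsChordalUniformizing φ → ∀ q : ℂ → ℂ, DifferentiableOn ℂ q D.carrier → (∀ w ∈ D.carrier, q w ^ 3 = deriv φ.symm w / φ.symm w) → ∃ θ : ℝ → ℂ, (∀ δ, ‖θ δ‖ = 1) ∧ ∀ i : Fin 2, TendstoLocallyUniformlyOn (fun (δ : ℝ) (w : ℂ) => θ δ * C * ((δ ^ (-(1 / 3 : ℝ)) : ℝ) : ℂ) * G (E δ) (fun j => ⌊(if j = 0 then w.re else w.im) / δ⌋) i) q (𝓝[>] (0 : ℝ)) D.carrier)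

/-- item stmt-CriticalPhenomena-7295 · support · rank 9 · closed · proved by Summit.CriticalPhenomena.CardyFormulaZ2.Theorems.SLE6CurveExists_proof @ b2d3e0ae4bc2 (prover) · by planner
[support] Existence of the chordal SLE₆ random curve in every Dobrushin domain (= Literature fact
exists_isSLECurve specialised to κ = 6): ∀ D, ∃ Γ, IsSLECurve 6 D Γ. This is the one Literature
input every proof of MartingaleToSLE6 (indeed of SLE6LimitZ2 on any route: ConvergesInLawToSLE 6 D …
unfolds to ∃ Γ, IsSLECurve 6 D Γ ∧ …) must produce to NAME its limit. In the tree it is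
`exists_isSLECurve_at_of_ne_eight` (Literature/Probability/RandomPlanarGeometry/SLEExistenceAt.lean)
applied to the PROVED Rohde–Schramm trace theorem `hasSLETrace_of_ne_eight_holds`
(RohdeSchrammCor35Proofs.lean; axioms propext/choice/Quot.sound) and the single unproved cone fact
`tendsto_norm_sleTrace_atTop` (RS05 Thm 7.1, a.s. transience |γ(t)| → ∞). needs-fact:
Literature.Probability.RandomPlanarGeometry.tendsto_norm_sleTrace_atTop — closing this item =
proving RS05 Thm 7.1 at κ = 6 (or all κ > 0). Filed by route-repair (cone guardrail) to make the
route's only genuine fact-debt typed and shareable (every route through SLE6LimitZ2 — CardyViaSLE6,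
CardyRotToConf, … — needs the same). Sources: RohdeSchramm2005 Thm 5.1 + Thm 7.1; Lawler2005 §6.3.
Difficulty: XL (provable-now modulo the transience fact). -/
@[route_item "route-CriticalPhenomena-CardyDualCurrent"]
def SLE6CurveExists : Prop :=
  ∀ D : Literature.Probability.RandomPlanarGeometry.DobrushinDomain, ∃ Γ, Literature.Probability.RandomPlanarGeometry.IsSLECurve (6 : NNReal) D Γ

-- earlier Assembly (stmt-CriticalPhenomena-5814, replaced 2026-08-15T16:23:17Z -> stmt-CriticalPhenomena-10758): retired by None — DualCurrentTemplate → CanonicalLimitFromExactCR → MartingaleToSLE6 → SLE6ToCardy → CardyFormulaZ2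
/-- item stmt-CriticalPhenomena-10758 · assembly · rank 1 · closed · proved by Summit.CriticalPhenomena.CardyFormulaZ2.Theorems.cardyDualCurrent_assembly_proof @ b4e002811808 (prover) · by planner
sources: Smirnov2010, KemppainenSmirnov2017, CamiaNewman2007
[assembly] Pure logic, rewired to the repaired crux: DualCurrentTemplateR →
CanonicalLimitFromExactCR → MartingaleToSLE6 → SLE6ToCardy → CardyFormulaZ2, proved by `fun h2 h4 h5
h9 => h9 (h5 (h4 h2))` (this is literally the certified deciding theorem `closes`).
NoDualCurrentRangeOne / NoDualCurrentRangeZero (negative side), TemplateCanonicalLimit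
(intermediate) and SLE6CurveExists (shared fact-debt) are not hypotheses. -/
@[route_item "route-CriticalPhenomena-CardyDualCurrent"]
def Assembly : Prop :=
  DualCurrentTemplateR → CanonicalLimitFromExactCR → MartingaleToSLE6 → SLE6ToCardy → CardyFormulaZ2

-- records of items no longer active in this route (dropped / restated):
-- earlier SLE6LimitZ2 (stmt-CriticalPhenomena-11324, replaced 2026-08-15T17:35:20Z -> stmt-CriticalPhenomena-11283): retired by None — Literature.Probability.Percolation.SLE6LimitZ2
-- earlier DualCurrentTemplate (stmt-CriticalPhenomena-5808, replaced 2026-08-15T11:56:03Z -> stmt-CriticalPhenomena-6949): retired by None — ∃ (r m : ℕ) (z : Fin 2 → Fin m → Literature.Probability.LatticeModels.MedialVertex) (s : Fin 2 → Fin m → ℝ) (g : Fin 2 → Fin m → Set Literature.Probability.LatticeModels.MedialVertex → ℂ), (∀ i k, Literature.Probability.LatticeModels.medialGraph.dist s((0 : Lit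
-- earlier DualCurrentTemplate (stmt-CriticalPhenomena-6949, dropped 2026-08-15T16:23:17Z): refuted by Summit.CriticalPhenomena.CardyFormulaZ2.Theorems.CardyDualCurrentDualCurrentTemplate_refuted @ 136cb0969686 — ∃ (r m : ℕ) (z : Fin 2 → Fin m → Literature.Probability.LatticeModels.MedialVertex) (s : Fin 2 → Fin m → ℝ) (g : Fin 2 → Fin m → Set Literature.Probability.LatticeModels.MedialVertex → ℂ), (

/-! D-0027 §2.1 — DECIDING THEOREM (planner-authored via `route open/edit --closes-file`; by planner-rrefute-CriticalPhenomena-CardyDualCur-fe2fa0f1-g5-0 2026-08-15T17:35:20Z):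
its hypotheses are this route's items and its conclusion the sub-problem Statement (glue_lint), and it elaborates with this file. -/

@[closes "route-CriticalPhenomena-CardyDualCurrent"] theorem closes : DualCurrentTemplateR → CanonicalLimitFromExactCR → MartingaleToSLE6 → SLE6ToCardy → _root_.CardyFormulaZ2 :=
  fun h2 h4 h5 h9 => h9 (h5 (h4 h2))

end Summit.CriticalPhenomena.CardyFormulaZ2.Theses.CardyDualCurrent
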